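import Mathlib
import Summits.KontsevichZagierPeriods.Zeta5Search.LawA3Proof
import Summits.KontsevichZagierPeriods.Zeta5Search.SecondOrderShiftInv
import HarnessLib

/-!
# ζ(5) search — criterion C2*: the second-order directions of `b + e_j` are second-order directions of `b`

Cell `pub-zeta5` (HONEST FRAMING: systematic search; no irrationality claim unless certified), typer seat generation 11.
REPORT-gen2-g10 §2.3/§3 for the GENERAL form of THEOREM A‴ (`SecondOrder.SecondOrderCollinearity`): in the regime of that statement
(every multipole class of exponent `≥ −M`, single-pole classes `ν ≥ −M+1`, classes of exponent `−M` non-self-conjugate with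
palindromic type list) the set of direction vectors of `b + e_j` — `τ_x` for its deep classes, the `(ŵ, v̂)`-orbit vectors of its
live sub-deep classes — is CONTAINED in the corresponding set for `b`:
* `H3p_shift` — the regime transports; `deep_transfer` — a deep class of `b + e_j` is an unhit deep class of `b` with the same `τ`;
* `isRaise_of_hit` — a class through exactly one moved point has as new type list a single raise of the old one;
* `sub_transfer` — a live sub-deep class of `b + e_j` is either an unhit live sub-deep class of `b` with the same orbit vector, or
  a hit deep class `y` of `b`, and then its orbit vector is `τ_y(b)` (raise lemma `live_pair` + `deep_data`).
`p`-adic bookkeeping of a systematic search; nothing here bears on irrationality.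
-/

noncomputable section

open Finset

namespace Summit.KontsevichZagierPeriods.Zeta5Search.SecondOrder

open Summit.KontsevichZagierPeriods.Zeta5Search.DualSeries (InBox)
open Summit.KontsevichZagierPeriods.Zeta5Search.CasoratianValuation (InPolytope shift)
open Summit.KontsevichZagierPeriods.Zeta5Search.ClusterValuation
open Summit.KontsevichZagierPeriods.Zeta5Search.BigPrime (shift_zero)
open Summit.KontsevichZagierPeriods.Zeta5Search.CellKit (two_mul_le_of_shift classExp_shift_eq)

variable {p : ℕ} [hp : Fact p.Prime]

section Transfer

variable (b : ℕ → ℤ) {j : ℕ} (hb : InPolytope b) (hb' : InPolytope (shift b j)) (hj1 : 1 ≤ j) (hj7 : j ≤ 7)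
  (hpn : (p : ℤ) ≤ b 0) {M : ℕ} (hM : 6 ≤ M) (hMe : Even M)
  (H1 : ∀ x ∈ multipoleClasses b p, -(M : ℤ) ≤ classExp b p x)
  (H2 : ∀ y, y < p → classPoleCount b p y = 1 → -(M : ℤ) + 1 ≤ classNu b p y)
  (H3 : ∀ x ∈ multipoleClasses b p, classExp b p x = -(M : ℤ) →
    ¬ CentreIn b p x ∧ (classTypeList b p x).reverse = classTypeList b p x)
include hb hb' hj1 hj7 hpn hM hMe H1 H2 H3

omit hMe hM H2 in
/-- **The regime transports**: a deep class of `b + e_j` is an unhit deep class of `b` (same centre status, same type list). -/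
theorem H3p_shift : ∀ x ∈ multipoleClasses (shift b j) p, classExp (shift b j) p x = -(M : ℤ) →
    ¬ CentreIn (shift b j) p x ∧ (classTypeList (shift b j) p x).reverse = classTypeList (shift b j) p x := by
  intro x hx hE
  obtain ⟨hxr, h2⟩ := mem_filter.1 hx
  have hxp := mem_range.1 hxr
  have h2b : 2 ≤ classPoleCount b p x := le_trans h2 (classPoleCount_shift_le b hb.1 hj1 p x)
  have hEb := H1 x (mem_filter.2 ⟨hxr, h2b⟩)
  have hge := classExp_shift_ge b hb.1 hj1 p x
  have heq : classExp (shift b j) p x = classExp b p x := by omega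
  obtain ⟨hc, hpal⟩ := H3 x (mem_filter.2 ⟨hxr, h2b⟩) (by omega)
  refine ⟨fun h => hc ((centreIn_shift b hj1 p x).1 h), ?_⟩
  rw [classTypeList_shift_of_unhit b hb hb' hj1 hj7 heq (le_b0_of_lt b hpn hxp)]
  exact hpal

omit hp hb' hj7 hpn hMe hM H2 H3 in
/-- **Deep classes transfer**: a deep class of `b + e_j` is a deep class of `b` with the same `τ`. -/
theorem deep_transfer {x : ℕ} (hx : x ∈ multipoleClasses (shift b j) p) (hE : classExp (shift b j) p x = -(M : ℤ)) :
    x ∈ multipoleClasses b p ∧ classExp b p x = -(M : ℤ) ∧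
      tauW (shift b j) p x = tauW b p x ∧ tauV (shift b j) p x = tauV b p x := by
  obtain ⟨hxr, h2⟩ := mem_filter.1 hx
  have h2b : 2 ≤ classPoleCount b p x := le_trans h2 (classPoleCount_shift_le b hb.1 hj1 p x)
  have hxm : x ∈ multipoleClasses b p := mem_filter.2 ⟨hxr, h2b⟩
  have hEb := H1 x hxm
  have hge := classExp_shift_ge b hb.1 hj1 p x
  have heq : classExp (shift b j) p x = classExp b p x := by omega
  exact ⟨hxm, by omega, tauW_shift_of_classExp_eq b hb.1 hj1 heq, tauV_shift_of_classExp_eq b hb.1 hj1 heq⟩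

omit hM hMe H1 H2 H3 in
/-- **A class through exactly one moved point gets a single raise of its type list** (REPORT-gen2-g10 §2.3). -/
theorem isRaise_of_hit {y : ℕ} (hy : y < p) (hone : classExp (shift b j) p y = classExp b p y + 1) :
    isRaise (classTypeList b p y) (classTypeList (shift b j) p y) = true := by
  have hp0 : 0 < p := hp.out.pos
  have hyn : y ≤ (b 0).toNat := le_b0_of_lt b hpn hy
  have h2 := two_mul_le_of_shift b hj1 hj7 hb'
  have hsum := classExp_shift_eq b hb hj1 hj7 hb' p y
  have hone' : ∑ s ∈ classSet b p y,
      (if s = (b j).toNat ∨ s = (b 0).toNat - (b j).toNat then (1 : ℤ) else 0) = 1 := by omega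
  rw [sum_boole] at hone'
  have hcard : ((classSet b p y).filter fun s => s = (b j).toNat ∨ s = (b 0).toNat - (b j).toNat).card = 1 := by
    exact_mod_cast hone'
  obtain ⟨s₀, hs₀⟩ := card_eq_one.1 hcard
  have hs₀mem : s₀ ∈ (classSet b p y).filter fun s => s = (b j).toNat ∨ s = (b 0).toNat - (b j).toNat := by
    rw [hs₀]; exact mem_singleton_self _
  obtain ⟨hs₀c, hs₀mv⟩ := mem_filter.1 hs₀mem
  obtain ⟨hL, hL'⟩ := level_bounds' (p := p) b hyn
  set L := topLevel b p y with hLdef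
  rw [LevelClass.classSet_level b hy hL hL'] at hs₀c
  obtain ⟨ℓ₀, hℓ₀, rfl⟩ := mem_image.1 hs₀c
  -- the new exponents along the levels
  have hnew : ∀ ℓ ≤ L, netExp (shift b j) (y + ℓ * p) = raiseAt (fun k => netExp b (y + k * p)) ℓ₀ ℓ := by
    intro ℓ hℓ
    rw [CellA.netExp_shift_eq b hb.1 hj1 hj7 h2, raiseAt]
    have hmem : y + ℓ * p ∈ classSet b p y := LevelClass.level_mem b hy hL hL' hℓ
    by_cases hℓℓ : ℓ = ℓ₀
    · subst hℓℓ; rw [if_pos hs₀mv, if_pos rfl]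
    · have hnot : ¬ (y + ℓ * p = (b j).toNat ∨ y + ℓ * p = (b 0).toNat - (b j).toNat) := by
        intro h
        have : y + ℓ * p ∈ (classSet b p y).filter fun s => s = (b j).toNat ∨ s = (b 0).toNat - (b j).toNat :=
          mem_filter.2 ⟨hmem, h⟩
        rw [hs₀, mem_singleton] at this
        exact hℓℓ (LevelClass.level_injective hp0 y this)
      rw [if_neg hnot, if_neg hℓℓ, add_zero]
  have htop : topLevel (shift b j) p y = L := by rw [hLdef]; unfold topLevel; rw [shift_zero b hj1]
  have hS : classTypeList (shift b j) p y = (List.range (L + 1)).map (raiseAt (fun k => netExp b (y + k * p)) ℓ₀) := by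
    unfold classTypeList
    rw [htop]
    exact List.map_congr_left fun ℓ hℓ => hnew ℓ (by have := List.mem_range.1 hℓ; omega)
  have hT' : classTypeList b p y = (List.range (L + 1)).map (fun k => netExp b (y + k * p)) := classTypeList_level b hL hL'
  rw [hS, ← mapIdx_range_map, hT']
  unfold isRaise
  simp only [Bool.or_eq_true, List.any_eq_true, beq_iff_eq]
  left; left
  refine ⟨ℓ₀, List.mem_range.2 ?_, rfl⟩
  simp; have := mem_range.1 hℓ₀; omega

/-- **Live sub-deep classes transfer**: a live sub-deep class `y` of `b + e_j` (`ν_y = −M+1`) is EITHER an unhit live sub-deep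
class of `b` with the same orbit vector, OR a hit deep class of `b`, and then its orbit vector in `b + e_j` is `τ_y(b)`. -/
theorem sub_transfer {y : ℕ} (hy : y < p) (h1 : 1 ≤ classPoleCount (shift b j) p y)
    (hnu : classNu (shift b j) p y = -(M : ℤ) + 1) :
    (1 ≤ classPoleCount b p y ∧ classNu b p y = -(M : ℤ) + 1 ∧
        orbitW (shift b j) p y = orbitW b p y ∧ orbitV (shift b j) p y = orbitV b p y) ∨
      (y ∈ multipoleClasses b p ∧ classExp b p y = -(M : ℤ) ∧
        orbitW (shift b j) p y = tauW b p y ∧ orbitV (shift b j) p y = tauV b p y) := by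
  have h0 : 0 ≤ b 0 := hb.1.1
  have h0' : 0 ≤ shift b j 0 := by rw [shift_zero b hj1]; exact h0
  have hyn : y ≤ (b 0).toNat := le_b0_of_lt b hpn hy
  have hyn' : y ≤ (shift b j 0).toNat := by rw [shift_zero b hj1]; exact hyn
  have hcb := classPoleCount_shift_le b hb.1 hj1 p y
  have hge := classExp_shift_ge b hb.1 hj1 p y
  -- `ν⁺ = E⁺ = −M+1` (a tame single class has `ν ≥ 0`)
  have hEq : classNu (shift b j) p y = classExp (shift b j) p y := by
    by_contra hne
    have := (tame_of_classNu_ne (shift b j) hne).2; omega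
  have hE' : classExp (shift b j) p y = -(M : ℤ) + 1 := by rw [← hEq]; exact hnu
  by_cases heq : classExp (shift b j) p y = classExp b p y
  · -- unhit: everything transports, on `y` and on `ȳ`
    left
    have h1b : 1 ≤ classPoleCount b p y := by rw [← classPoleCount_shift_of_classExp_eq b hb.1 hj1 heq]; exact h1
    have hnub : classNu b p y = -(M : ℤ) + 1 := by
      by_cases hne : classNu b p y = classExp b p y
      · rw [hne, ← heq]; exact hE'
      · exfalso
        obtain ⟨h1b', -⟩ := tame_of_classNu_ne b hne
        have htame : tameSingle b p y = true := by
          by_contra ht; apply hne; unfold classNu; rw [if_neg (fun h => ht h.2)]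
        have ht' := tameSingle_shift b hb hb' hj1 hj7 h1b' h1 htame
        have h1' : classPoleCount (shift b j) p y = 1 := by
          rw [classPoleCount_shift_of_classExp_eq b hb.1 hj1 heq]; exact h1b'
        apply (show classNu (shift b j) p y ≠ classExp (shift b j) p y from ?_) hEq
        intro h
        have : 0 ≤ classNu (shift b j) p y := by unfold classNu; rw [if_pos ⟨h1', ht'⟩]; exact le_max_right _ _
        omega
    have hcs : conjClass (shift b j) p y = conjClass b p y := by unfold conjClass; rw [shift_zero b hj1]
    have heqc : classExp (shift b j) p (conjClass b p y) = classExp b p (conjClass b p y) := by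
      rw [← hcs, classExp_conj (shift b j) h0' hyn', hcs, classExp_conj b h0 hyn, heq]
    exact ⟨h1b, hnub, orbitW_shift_of_classExp_eq b hb.1 hj1 heq heqc, orbitV_shift_of_classExp_eq b hb.1 hj1 heq heqc⟩
  · -- hit: `y` was deep in `b`
    right
    have hlt : classExp b p y + 1 ≤ classExp (shift b j) p y := by omega
    by_cases h2b : 2 ≤ classPoleCount b p y
    · have hym : y ∈ multipoleClasses b p := mem_filter.2 ⟨mem_range.2 hy, h2b⟩
      have hEb := H1 y hym
      have hEm : classExp b p y = -(M : ℤ) := by omega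
      obtain ⟨hc, hpal⟩ := H3 y hym hEm
      have hr := isRaise_of_hit b hb hb' hj1 hj7 hpn hy (by omega)
      have hpn1 : (p : ℤ) ≤ shift b j 0 := by rw [shift_zero b hj1]; exact hpn
      obtain ⟨hw, hv⟩ := live_pair (shift b j) hb' hpn1 hpal hy h1 (by omega) (Or.inl hr)
      have hodd : Odd (3 + classExp b p y) := by
        rw [hEm]; obtain ⟨r, hr'⟩ := hMe; exact ⟨1 - (r : ℤ), by omega⟩
      obtain ⟨-, htw, htv, -⟩ := deep_data b hb hpn hpal hy hc rfl hodd
      have hc' : ¬ CentreIn (shift b j) p y := fun h => hc ((centreIn_shift b hj1 p y).1 h)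
      refine ⟨hym, hEm, ?_, ?_⟩
      · unfold orbitW; rw [if_neg hc', htw]; exact hw
      · unfold orbitV; rw [if_neg hc', htv]; exact hv
    · -- a hit single class: tame, contradiction
      exfalso
      have h1b : classPoleCount b p y = 1 := by omega
      have hnub := H2 y hy h1b
      have hne : classNu b p y ≠ classExp b p y := by omega
      have htame : tameSingle b p y = true := by
        by_contra ht; apply hne; unfold classNu; rw [if_neg (fun h => ht h.2)]
      have ht' := tameSingle_shift b hb hb' hj1 hj7 h1b h1 htame
      have h1' : classPoleCount (shift b j) p y = 1 := by omega
      have : 0 ≤ classNu (shift b j) p y := by unfold classNu; rw [if_pos ⟨h1', ht'⟩]; exact le_max_right _ _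
      omega

end Transfer

end Summit.KontsevichZagierPeriods.Zeta5Search.SecondOrder

end
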